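import Literature.Analysis.Convex.ConeLift
import Mathlib.Analysis.Convex.Basic
import Mathlib.LinearAlgebra.Dimension.Free
import Mathlib.LinearAlgebra.Dimension.RankNullity
import Mathlib.LinearAlgebra.FiniteDimensional.Lemmas
import Mathlib.LinearAlgebra.FreeModule.Finite.Basic
import Mathlib.LinearAlgebra.AffineSpace.AffineSubspace.Basic
import Mathlib.Algebra.Order.Star.Real
import Mathlib.Topology.Algebra.Order.Field
import Mathlib.Tactic.Positivity
import Mathlib.Tactic.FieldSimp
import Mathlib.Tactic.FunProp
import HarnessLib

/-!
# Calculus of exp+psd lifts; convexity; log-sum-exp and free-energy lifts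

Continuation of `Literature.Analysis.Convex.ConeLift` (the notion `HasExpPsdLift C k m` of a
`K_exp^k × S^m_+`-lift of a set `C`, [GPT13, Def. 2.1] in the conic-inequality form of
Ben-Tal–Nemirovski).  Here:

* the **calculus** of representable sets ([BEN09, App. A.2.4.2 rules (i)–(iv)]; [BTN01]):
  `HasExpPsdLift.inter`, `.prod`, `.fst_image` (coordinate projection = partial minimisation
  over a finite-dimensional factor), `hasExpPsdLift_setOf_eq` (affine equations),
  `.image` (linear images between finite-dimensional spaces) — sizes add up exactly;
* `convex_expCone`, `isClosed_expCone` (so `K_exp^k × S^m_+` is a closed convex cone, as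
  required in [GPT13, Def. 2.1]) via the half-space description `mem_expCone_iff_forall`, and
  `HasExpPsdLift.convex`: lifted sets are convex;
* `hasExpPsdLift_logSumExp`: the epigraph of `x ↦ log Σ_{i ∈ ι} exp (a_i x + c_i)` (`ι` finite
  nonempty, `a_i` linear) has a lift with `|ι| + 1` exponential cones and no psd block
  (geometric programming: `t ≥ log Σ exp vᵢ ↔ ∃ y, exp (vᵢ - t) ≤ yᵢ, Σ yᵢ ≤ 1`);
* `hasExpPsdLift_freeEnergyEpigraph_of_coeff_nonneg`: hence the free-energy epigraph of a
  nonzero polynomial with nonnegative coefficients has a lift with `#support + 1` exponential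
  cones (the "trivial lift", e.g. `n! + 1` cones for the permanent);
* `HasExpPsdProjLift` — [GPT13, Def. 2.1] VERBATIM (`C = π (K ∩ L)`, `L` an affine subspace of
  `LiftSpace k m`, `π` linear) and the equivalence with `HasExpPsdLift` for finite-dimensional
  `E` up to `O(k + m² + dim E)` exponential-cone units, same psd order
  (`HasExpPsdProjLift.hasExpPsdLift`, `HasExpPsdLift.hasExpPsdProjLift`,
  `hasExpPsdLift_iff_exists_hasExpPsdProjLift`).  BOOKKEEPING CAVEAT: the conic-inequality
  form does not count free variables and linear (in)equalities (`hasExpPsdLift_univ :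
  HasExpPsdLift univ 0 0`, while no GPT lift of size `0` presents `univ` for `dim E > 0`), so a
  lower bound on GPT-lift size / cone rank from the literature transfers to `HasExpPsdLift C k m`
  only in the form "`k + dim E ≥` bound" (`HasExpPsdLift.hasExpPsdProjLift`); immaterial for
  quasi-polynomial bounds in `dim E = poly(n)` variables.

## References

* [GPT13] Gouveia–Parrilo–Thomas, *Lifts of convex sets and cone factorizations*, MOR 2013,
  Def. 2.1 (bib: GouveiaParriloThomas2013).
* [BTN01] Ben-Tal–Nemirovski, *Lectures on Modern Convex Optimization*, SIAM 2001
  (bib: BentalNemirovski2001), calculus of `K`-representable sets.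
* [BEN09] Ben-Tal–El Ghaoui–Nemirovski, *Robust Optimization*, PUP 2009: App. A.2.4.1
  eq. (A.2.11) (`K`-representable set `{y | ∃ u, Ay + Bu - b ∈ K}`), A.2.4.2 (calculus rules
  (i) intersections, (ii) direct products, (iii) inverse affine images, (iv) affine images)
  (bib: BentalElghaouiNemirovski2009).
-/

noncomputable section

open Matrix

namespace Literature.Analysis.Convex

variable {E : Type*} [AddCommGroup E] [Module ℝ E]

/-! ## Appending coordinates -/

section append

variable (V : Type*) [AddCommGroup V] [Module ℝ V]

/-- `Fin.append` as an `ℝ`-linear map `V^{k₁} × V^{k₂} → V^{k₁ + k₂}`. [folklore] -/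
def appendLin (k₁ k₂ : ℕ) : (Fin k₁ → V) × (Fin k₂ → V) →ₗ[ℝ] (Fin (k₁ + k₂) → V) where
  toFun w := Fin.append w.1 w.2
  map_add' w w' := by
    funext i
    refine Fin.addCases (fun j => ?_) (fun j => ?_) i <;>
      simp [Fin.append_left, Fin.append_right]
  map_smul' c w := by
    funext i
    refine Fin.addCases (fun j => ?_) (fun j => ?_) i <;>
      simp [Fin.append_left, Fin.append_right]

variable {V}

/-- Unfolding of `appendLin`. [folklore] -/
theorem appendLin_apply {k₁ k₂ : ℕ} (w : (Fin k₁ → V) × (Fin k₂ → V)) :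
    appendLin V k₁ k₂ w = Fin.append w.1 w.2 :=
  rfl

/-- A property holds for all appended entries iff it holds on both pieces. [folklore] -/
theorem forall_appendLin_iff {k₁ k₂ : ℕ} (P : V → Prop) (w : (Fin k₁ → V) × (Fin k₂ → V)) :
    (∀ i, P (appendLin V k₁ k₂ w i)) ↔ (∀ i, P (w.1 i)) ∧ ∀ j, P (w.2 j) := by
  constructor
  · intro h
    exact ⟨fun i => by simpa [appendLin_apply, Fin.append_left] using h (Fin.castAdd k₂ i),
      fun j => by simpa [appendLin_apply, Fin.append_right] using h (Fin.natAdd k₁ j)⟩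
  · rintro ⟨h₁, h₂⟩ i
    refine Fin.addCases (fun j => ?_) (fun j => ?_) i
    · simpa [appendLin_apply, Fin.append_left] using h₁ j
    · simpa [appendLin_apply, Fin.append_right] using h₂ j

variable (V)

/-- Splitting `V^{p₁ + p₂}` into `V^{p₁} × V^{p₂}` (restriction along `Fin.castAdd`,
`Fin.natAdd`). [folklore] -/
def splitFin (p₁ p₂ : ℕ) : (Fin (p₁ + p₂) → V) →ₗ[ℝ] (Fin p₁ → V) × (Fin p₂ → V) :=
  (LinearMap.funLeft ℝ V (Fin.castAdd p₂)).prod (LinearMap.funLeft ℝ V (Fin.natAdd p₁))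

variable {V}

/-- `splitFin ∘ appendLin = id`. [folklore] -/
theorem splitFin_appendLin {p₁ p₂ : ℕ} (w : (Fin p₁ → V) × (Fin p₂ → V)) :
    splitFin V p₁ p₂ (appendLin V p₁ p₂ w) = w := by
  obtain ⟨u, v⟩ := w
  refine Prod.ext (funext fun i => ?_) (funext fun j => ?_)
  · simp [splitFin, appendLin_apply, LinearMap.funLeft_apply, Fin.append_left]
  · simp [splitFin, appendLin_apply, LinearMap.funLeft_apply, Fin.append_right]

/-- Existential quantification over `V^{p₁+p₂}` splits. [folklore] -/
theorem exists_splitFin_iff {p₁ p₂ : ℕ} (P : (Fin p₁ → V) → (Fin p₂ → V) → Prop) :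
    (∃ y : Fin (p₁ + p₂) → V, P (splitFin V p₁ p₂ y).1 (splitFin V p₁ p₂ y).2) ↔
      ∃ y₁ y₂, P y₁ y₂ := by
  constructor
  · rintro ⟨y, h⟩
    exact ⟨_, _, h⟩
  · rintro ⟨y₁, y₂, h⟩
    refine ⟨appendLin V p₁ p₂ (y₁, y₂), ?_⟩
    rwa [splitFin_appendLin]

end append

/-- Juxtaposition of lift coordinates
`LiftSpace k₁ m₁ × LiftSpace k₂ m₂ → LiftSpace (k₁+k₂) (m₁+m₂)`: append the exponential-cone
triples and place the two psd blocks on the diagonal. [folklore] -/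
def LiftSpace.append (k₁ m₁ k₂ m₂ : ℕ) :
    LiftSpace k₁ m₁ × LiftSpace k₂ m₂ →ₗ[ℝ] LiftSpace (k₁ + k₂) (m₁ + m₂) :=
  ((appendLin (ℝ × ℝ × ℝ) k₁ k₂).comp
      ((LinearMap.fst ℝ _ _).prodMap (LinearMap.fst ℝ _ _))).prod
    ((padMatrix (Fin.castAdd m₂)).comp ((LinearMap.snd ℝ _ _).comp (LinearMap.fst ℝ _ _)) +
      (padMatrix (Fin.natAdd m₁)).comp ((LinearMap.snd ℝ _ _).comp (LinearMap.snd ℝ _ _)))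

/-- The juxtaposition lies in `K_exp^{k₁+k₂} × S^{m₁+m₂}_+` iff both pieces lie in their cones
(block-diagonal psd ↔ blocks psd). [folklore] -/
theorem LiftSpace.append_mem_iff {k₁ m₁ k₂ m₂ : ℕ} (w₁ : LiftSpace k₁ m₁) (w₂ : LiftSpace k₂ m₂) :
    LiftSpace.append k₁ m₁ k₂ m₂ (w₁, w₂) ∈ expPsdCone (k₁ + k₂) (m₁ + m₂) ↔
      w₁ ∈ expPsdCone k₁ m₁ ∧ w₂ ∈ expPsdCone k₂ m₂ := by
  change ((∀ i, appendLin (ℝ × ℝ × ℝ) k₁ k₂ (w₁.1, w₂.1) i ∈ expCone) ∧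
      (padMatrix (Fin.castAdd m₂) w₁.2 + padMatrix (Fin.natAdd m₁) w₂.2).PosSemidef) ↔ _
  rw [forall_appendLin_iff (fun v => v ∈ expCone),
    posSemidef_padMatrix_add_iff (Fin.castAdd_injective _ _) (Fin.natAdd_injective _ _)]
  · simp only [mem_expPsdCone_iff]
    tauto
  · intro a b h
    have := congrArg Fin.val h
    simp only [Fin.val_castAdd, Fin.val_natAdd] at this
    omega

/-! ## Intersections, products, projections, equations, images -/

/-- **Intersections.** Lifts of `C` and `D` juxtapose to a lift of `C ∩ D`; cone counts add.
[cite: BentalElghaouiNemirovski2009, App. A.2.4.2 rule (i)] -/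
theorem HasExpPsdLift.inter {C D : Set E} {k₁ m₁ k₂ m₂ : ℕ} (hC : HasExpPsdLift C k₁ m₁)
    (hD : HasExpPsdLift D k₂ m₂) : HasExpPsdLift (C ∩ D) (k₁ + k₂) (m₁ + m₂) := by
  obtain ⟨p₁, A₁, b₁, rfl⟩ := hC
  obtain ⟨p₂, A₂, b₂, rfl⟩ := hD
  refine ⟨p₁ + p₂, (LiftSpace.append k₁ m₁ k₂ m₂).comp
      ((A₁.comp (LinearMap.id.prodMap ((LinearMap.fst ℝ _ _).comp (splitFin ℝ p₁ p₂)))).prod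
        (A₂.comp (LinearMap.id.prodMap ((LinearMap.snd ℝ _ _).comp (splitFin ℝ p₁ p₂))))),
    LiftSpace.append k₁ m₁ k₂ m₂ (b₁, b₂), ?_⟩
  ext x
  simp only [Set.mem_inter_iff, Set.mem_setOf_eq]
  rw [show ((∃ y₁, A₁ (x, y₁) + b₁ ∈ expPsdCone k₁ m₁) ∧ ∃ y₂, A₂ (x, y₂) + b₂ ∈ expPsdCone k₂ m₂) ↔
      ∃ y₁ y₂, A₁ (x, y₁) + b₁ ∈ expPsdCone k₁ m₁ ∧ A₂ (x, y₂) + b₂ ∈ expPsdCone k₂ m₂ from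
    ⟨fun ⟨⟨y₁, h₁⟩, ⟨y₂, h₂⟩⟩ => ⟨y₁, y₂, h₁, h₂⟩, fun ⟨y₁, y₂, h₁, h₂⟩ => ⟨⟨y₁, h₁⟩, ⟨y₂, h₂⟩⟩⟩,
    ← exists_splitFin_iff (V := ℝ)
      (fun y₁ y₂ => A₁ (x, y₁) + b₁ ∈ expPsdCone k₁ m₁ ∧ A₂ (x, y₂) + b₂ ∈ expPsdCone k₂ m₂)]
  refine exists_congr fun y => ?_
  rw [LinearMap.comp_apply, ← map_add]
  exact (LiftSpace.append_mem_iff _ _).symm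

/-- **Products.** Lifts of `C ⊆ E` and `D ⊆ F` juxtapose to a lift of `C ×ˢ D`; cone counts add.
[cite: BentalElghaouiNemirovski2009, App. A.2.4.2 rule (ii)] -/
theorem HasExpPsdLift.prod {F : Type*} [AddCommGroup F] [Module ℝ F] {C : Set E} {D : Set F}
    {k₁ m₁ k₂ m₂ : ℕ} (hC : HasExpPsdLift C k₁ m₁) (hD : HasExpPsdLift D k₂ m₂) :
    HasExpPsdLift (C ×ˢ D) (k₁ + k₂) (m₁ + m₂) := by
  obtain ⟨p₁, A₁, b₁, rfl⟩ := hC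
  obtain ⟨p₂, A₂, b₂, rfl⟩ := hD
  refine ⟨p₁ + p₂, (LiftSpace.append k₁ m₁ k₂ m₂).comp
      ((A₁.comp ((LinearMap.fst ℝ E F).prodMap
          ((LinearMap.fst ℝ _ _).comp (splitFin ℝ p₁ p₂)))).prod
        (A₂.comp ((LinearMap.snd ℝ E F).prodMap
          ((LinearMap.snd ℝ _ _).comp (splitFin ℝ p₁ p₂))))),
    LiftSpace.append k₁ m₁ k₂ m₂ (b₁, b₂), ?_⟩
  ext ⟨x, z⟩
  simp only [Set.mem_prod, Set.mem_setOf_eq]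
  rw [show ((∃ y₁, A₁ (x, y₁) + b₁ ∈ expPsdCone k₁ m₁) ∧ ∃ y₂, A₂ (z, y₂) + b₂ ∈ expPsdCone k₂ m₂) ↔
      ∃ y₁ y₂, A₁ (x, y₁) + b₁ ∈ expPsdCone k₁ m₁ ∧ A₂ (z, y₂) + b₂ ∈ expPsdCone k₂ m₂ from
    ⟨fun ⟨⟨y₁, h₁⟩, ⟨y₂, h₂⟩⟩ => ⟨y₁, y₂, h₁, h₂⟩, fun ⟨y₁, y₂, h₁, h₂⟩ => ⟨⟨y₁, h₁⟩, ⟨y₂, h₂⟩⟩⟩,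
    ← exists_splitFin_iff (V := ℝ)
      (fun y₁ y₂ => A₁ (x, y₁) + b₁ ∈ expPsdCone k₁ m₁ ∧ A₂ (z, y₂) + b₂ ∈ expPsdCone k₂ m₂)]
  refine exists_congr fun y => ?_
  rw [LinearMap.comp_apply, ← map_add]
  exact (LiftSpace.append_mem_iff _ _).symm

/-- **Coordinate projections** (partial minimisation / `inf`-projection over a finite-dimensional
factor): if `C ⊆ E × F` has a lift and `F` is finite-dimensional then the shadow
`{x | ∃ z, (x, z) ∈ C}` has a lift with the same cones (the `F`-coordinates become lifting
variables; a special affine image). [cite: BentalElghaouiNemirovski2009, App. A.2.4.2 rule (iv)] -/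
theorem HasExpPsdLift.fst_image {F : Type*} [AddCommGroup F] [Module ℝ F] [Module.Finite ℝ F]
    {C : Set (E × F)} {k m : ℕ} (hC : HasExpPsdLift C k m) :
    HasExpPsdLift (Prod.fst '' C) k m := by
  obtain ⟨p, A, b, rfl⟩ := hC
  set d := Module.finrank ℝ F
  let e : F ≃ₗ[ℝ] (Fin d → ℝ) := (Module.finBasis ℝ F).equivFun
  refine ⟨d + p, A.comp (((LinearMap.fst ℝ E _).prod (e.symm.toLinearMap.comp
      ((LinearMap.fst ℝ _ _).comp ((splitFin ℝ d p).comp (LinearMap.snd ℝ E _))))).prod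
        ((LinearMap.snd ℝ _ _).comp ((splitFin ℝ d p).comp (LinearMap.snd ℝ E _)))), b, ?_⟩
  ext x
  simp only [Set.mem_image, Set.mem_setOf_eq, Prod.exists, exists_and_right, exists_eq_right]
  constructor
  · rintro ⟨z, y, h⟩
    refine ⟨appendLin ℝ d p (e z, y), ?_⟩
    change A ((x, e.symm (splitFin ℝ d p (appendLin ℝ d p (e z, y))).1),
      (splitFin ℝ d p (appendLin ℝ d p (e z, y))).2) + b ∈ _
    rwa [splitFin_appendLin, LinearEquiv.symm_apply_apply]
  · rintro ⟨y', h⟩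
    exact ⟨e.symm (splitFin ℝ d p y').1, (splitFin ℝ d p y').2, h⟩

/-- **Affine equations.** `{x | T x = c}` with `T : E → F` linear and `F` finite-dimensional has a
lift by `dim F` exponential cones (one equation unit `(0, s, 0) ∈ K_exp` per coordinate) and no
psd block. [folklore] -/
theorem hasExpPsdLift_setOf_eq {F : Type*} [AddCommGroup F] [Module ℝ F] [Module.Finite ℝ F]
    (T : E →ₗ[ℝ] F) (c : F) : HasExpPsdLift {x | T x = c} (Module.finrank ℝ F) 0 := by
  set d := Module.finrank ℝ F
  let e : F ≃ₗ[ℝ] (Fin d → ℝ) := (Module.finBasis ℝ F).equivFun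
  rw [hasExpPsdLift_zero_iff]
  refine ⟨0, LinearMap.pi fun i => ((0 : E × (Fin 0 → ℝ) →ₗ[ℝ] ℝ).prod
      ((-((LinearMap.proj i).comp (e.toLinearMap.comp (T.comp (LinearMap.fst ℝ E _))))).prod 0)),
    fun i => (0, e c i, 0), fun x => ?_⟩
  change T x = c ↔
    ∃ _ : Fin 0 → ℝ, ∀ i, ((0 : ℝ), -(e (T x) i), (0 : ℝ)) + ((0 : ℝ), e c i, (0 : ℝ)) ∈ expCone
  simp only [Prod.mk_add_mk, add_zero, neg_add_eq_sub, mem_expCone_eq_iff, sub_eq_zero,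
    exists_const]
  rw [← funext_iff, e.injective.eq_iff, eq_comm]

/-- **Linear images.** If `C ⊆ E` has a lift and `L : E → F` is linear between
finite-dimensional spaces then `L '' C` has a lift with `dim F` extra exponential cones
(`L '' C` is the shadow of `{(z, x) | x ∈ C, z = L x}`).
[cite: BentalElghaouiNemirovski2009, App. A.2.4.2 rule (iv)] -/
theorem HasExpPsdLift.image {F : Type*} [AddCommGroup F] [Module ℝ F] [Module.Finite ℝ E]
    [Module.Finite ℝ F] {C : Set E} {k m : ℕ} (hC : HasExpPsdLift C k m) (L : E →ₗ[ℝ] F) :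
    HasExpPsdLift (L '' C) (k + Module.finrank ℝ F) m := by
  have h1 : HasExpPsdLift ((LinearMap.snd ℝ F E) ⁻¹' C) k m := hC.comap_linearMap _
  have h2 : HasExpPsdLift {q : F × E | (LinearMap.fst ℝ F E - L.comp (LinearMap.snd ℝ F E)) q = 0}
      (Module.finrank ℝ F) 0 := hasExpPsdLift_setOf_eq _ _
  have h3 := (h1.inter h2).fst_image
  have hset : L '' C = Prod.fst '' ((LinearMap.snd ℝ F E) ⁻¹' C ∩
      {q : F × E | (LinearMap.fst ℝ F E - L.comp (LinearMap.snd ℝ F E)) q = 0}) := by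
    ext z
    simp only [Set.mem_image, Set.mem_inter_iff, Set.mem_preimage, Set.mem_setOf_eq,
      LinearMap.sub_apply, LinearMap.fst_apply, LinearMap.comp_apply, LinearMap.snd_apply,
      sub_eq_zero, Prod.exists, exists_and_right, exists_eq_right]
    constructor
    · rintro ⟨x, hx, rfl⟩
      exact ⟨x, hx, rfl⟩
    · rintro ⟨x, hx, rfl⟩
      exact ⟨x, hx, rfl⟩
  rw [hset]
  exact h3

/-! ## Convexity and closedness -/

/-- **Half-space description of the exponential cone**: `(x, y, z) ∈ K_exp` iff `0 ≤ y`, `0 ≤ z`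
and `s·x - y·(s log s - s) ≤ z` for every `s > 0` (the supporting half-spaces of the perspective
of `exp`, whose convex conjugate is `s log s - s`; equality at `s = exp (x / y)`). [folklore] -/
theorem mem_expCone_iff_forall {x y z : ℝ} :
    (x, y, z) ∈ expCone ↔
      0 ≤ y ∧ 0 ≤ z ∧ ∀ s : ℝ, 0 < s → s * x - y * (s * Real.log s - s) ≤ z := by
  constructor
  · intro h
    obtain ⟨hy0, hz0⟩ := nonneg_of_mem_expCone h
    refine ⟨hy0, hz0, fun s hs => ?_⟩
    rcases h with ⟨hy, hz⟩ | ⟨hy, hx, -⟩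
    · refine le_trans ?_ hz
      have key : x / y - Real.log s + 1 ≤ Real.exp (x / y) / s := by
        have := Real.add_one_le_exp (x / y - Real.log s)
        rwa [Real.exp_sub, Real.exp_log hs] at this
      have key2 : s * (x / y - Real.log s + 1) ≤ Real.exp (x / y) := by
        have := mul_le_mul_of_nonneg_left key hs.le
        rwa [mul_div_cancel₀ _ hs.ne'] at this
      have key3 := mul_le_mul_of_nonneg_left key2 hy.le
      calc s * x - y * (s * Real.log s - s) = y * (s * (x / y - Real.log s + 1)) := by
            field_simp
            ring
        _ ≤ y * Real.exp (x / y) := key3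
    · simp only at hy hx
      rw [hy, zero_mul, sub_zero]
      exact (mul_nonpos_of_nonneg_of_nonpos hs.le hx).trans hz0
  · rintro ⟨hy0, hz0, h⟩
    rcases hy0.lt_or_eq with hy | hy
    · refine Or.inl ⟨hy, ?_⟩
      have := h (Real.exp (x / y)) (Real.exp_pos _)
      rwa [Real.log_exp,
        show Real.exp (x / y) * x - y * (Real.exp (x / y) * (x / y) - Real.exp (x / y))
          = y * Real.exp (x / y) by field_simp; ring] at this
    · refine Or.inr ⟨hy.symm, le_of_not_gt fun hx => ?_, hz0⟩
      have := h ((z + 1) / x) (div_pos (by linarith) hx)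
      rw [← hy, zero_mul, sub_zero, div_mul_cancel₀ _ hx.ne'] at this
      linarith

/-- The exponential cone is convex. [folklore] -/
theorem convex_expCone : Convex ℝ expCone := by
  rintro ⟨x, y, z⟩ hw ⟨x', y', z'⟩ hw' a b ha hb hab
  simp only [Prod.smul_mk, Prod.mk_add_mk, smul_eq_mul]
  rw [mem_expCone_iff_forall] at hw hw' ⊢
  obtain ⟨hy, hz, h⟩ := hw
  obtain ⟨hy', hz', h'⟩ := hw'
  refine ⟨by positivity, by positivity, fun s hs => ?_⟩
  have h1 := mul_le_mul_of_nonneg_left (h s hs) ha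
  have h2 := mul_le_mul_of_nonneg_left (h' s hs) hb
  nlinarith [h1, h2]

/-- The exponential cone is closed (an intersection of closed half-spaces). [folklore] -/
theorem isClosed_expCone : IsClosed expCone := by
  have hrepr : expCone = ({w : ℝ × ℝ × ℝ | 0 ≤ w.2.1} ∩ {w | 0 ≤ w.2.2}) ∩
      ⋂ (s : ℝ) (_ : 0 < s), {w : ℝ × ℝ × ℝ | s * w.1 - w.2.1 * (s * Real.log s - s) ≤ w.2.2} := by
    ext ⟨x, y, z⟩
    simp only [Set.mem_inter_iff, Set.mem_iInter, Set.mem_setOf_eq, mem_expCone_iff_forall,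
      and_assoc]
  rw [hrepr]
  refine ((isClosed_le continuous_const (by fun_prop)).inter
    (isClosed_le continuous_const (by fun_prop))).inter ?_
  exact isClosed_iInter fun s => isClosed_iInter fun _ => isClosed_le (by fun_prop) (by fun_prop)

/-- `K_exp^k × S^m_+` is convex. [folklore] -/
theorem convex_expPsdCone (k m : ℕ) : Convex ℝ (expPsdCone k m) := by
  intro w hw w' hw' a b ha hb hab
  refine ⟨fun i => ?_, ?_⟩
  · have := convex_expCone (hw.1 i) (hw'.1 i) ha hb hab
    simpa using this
  · change (a • w.2 + b • w'.2).PosSemidef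
    exact (hw.2.smul ha).add (hw'.2.smul hb)

/-- `K_exp^k × S^m_+` is closed under nonnegative scaling (a cone). [folklore] -/
theorem smul_mem_expPsdCone {k m : ℕ} {w : LiftSpace k m} (hw : w ∈ expPsdCone k m) {c : ℝ}
    (hc : 0 ≤ c) : c • w ∈ expPsdCone k m :=
  ⟨fun i => by simpa using smul_mem_expCone (hw.1 i) hc, hw.2.smul hc⟩

/-- **Lifted sets are convex** ("a K-representable set is always convex").
[cite: BentalElghaouiNemirovski2009, App. A.2.4.1] -/
theorem HasExpPsdLift.convex {C : Set E} {k m : ℕ} (h : HasExpPsdLift C k m) : Convex ℝ C := by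
  obtain ⟨p, A, b, rfl⟩ := h
  rintro x ⟨y, hy⟩ x' ⟨y', hy'⟩ a c ha hc hac
  refine ⟨a • y + c • y', ?_⟩
  have key : A (a • x + c • x', a • y + c • y') + b =
      a • (A (x, y) + b) + c • (A (x', y') + b) := by
    have hx : ((a • x + c • x', a • y + c • y') : E × (Fin p → ℝ)) = a • (x, y) + c • (x', y') :=
      rfl
    rw [hx, map_add, LinearMap.map_smul, LinearMap.map_smul, smul_add, smul_add]
    calc a • A (x, y) + c • A (x', y') + b
        = a • A (x, y) + c • A (x', y') + (a + c) • b := by rw [hac, one_smul]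
      _ = a • A (x, y) + a • b + (c • A (x', y') + c • b) := by rw [add_smul]; abel
  rw [key]
  exact convex_expPsdCone k m hy hy' ha hc hac

/-! ## Log-sum-exp and free energies -/

/-- **Geometric-programming lemma.** For a finite nonempty family `v`,
`log Σᵢ exp vᵢ ≤ t ↔ ∃ y, (∀ i, exp (vᵢ - t) ≤ yᵢ) ∧ Σᵢ yᵢ ≤ 1`. [folklore] -/
theorem log_sum_exp_le_iff {ι : Type*} [Fintype ι] [Nonempty ι] (v : ι → ℝ) (t : ℝ) :
    Real.log (∑ i, Real.exp (v i)) ≤ t ↔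
      ∃ y : ι → ℝ, (∀ i, Real.exp (v i - t) ≤ y i) ∧ ∑ i, y i ≤ 1 := by
  have hpos : 0 < ∑ i, Real.exp (v i) :=
    Finset.sum_pos (fun i _ => Real.exp_pos _) Finset.univ_nonempty
  have hsum : ∑ i, Real.exp (v i - t) = (∑ i, Real.exp (v i)) * Real.exp (-t) := by
    rw [Finset.sum_mul]
    refine Finset.sum_congr rfl fun i _ => ?_
    rw [← Real.exp_add, sub_eq_add_neg]
  rw [Real.log_le_iff_le_exp hpos]
  constructor
  · intro h
    refine ⟨fun i => Real.exp (v i - t), fun i => le_rfl, ?_⟩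
    rw [hsum]
    calc (∑ i, Real.exp (v i)) * Real.exp (-t) ≤ Real.exp t * Real.exp (-t) :=
          mul_le_mul_of_nonneg_right h (Real.exp_pos _).le
      _ = 1 := by rw [← Real.exp_add, add_neg_cancel, Real.exp_zero]
  · rintro ⟨y, hy, hs⟩
    have h1 : (∑ i, Real.exp (v i)) * Real.exp (-t) ≤ 1 :=
      hsum ▸ (Finset.sum_le_sum fun i _ => hy i).trans hs
    have h2 := mul_le_mul_of_nonneg_right h1 (Real.exp_pos t).le
    rwa [mul_assoc, ← Real.exp_add, neg_add_cancel, Real.exp_zero, mul_one, one_mul] at h2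

/-- The sum of the lifting coordinates, as a linear form on `M × ℝ^n`. [folklore] -/
def sumCoords (M : Type*) [AddCommGroup M] [Module ℝ M] (n : ℕ) : M × (Fin n → ℝ) →ₗ[ℝ] ℝ where
  toFun q := ∑ j, q.2 j
  map_add' q q' := by simp [Finset.sum_add_distrib]
  map_smul' r q := by simp [Finset.mul_sum]

/-- **Log-sum-exp has a small exponential-cone lift.** For finitely many (`ι` nonempty) affine
forms `x ↦ aᵢ x + cᵢ` on `E`, the epigraph `{(x, t) | log Σᵢ exp (aᵢ x + cᵢ) ≤ t}` has a lift by
`|ι| + 1` exponential cones and no psd block: `|ι|` cones `(aᵢ x + cᵢ - t, 1, yᵢ) ∈ K_exp` and one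
LP unit `(0, 1 - Σ yᵢ, 1 - Σ yᵢ) ∈ K_exp`. [folklore] -/
theorem hasExpPsdLift_logSumExp {ι : Type*} [Fintype ι] [Nonempty ι] (a : ι → E →ₗ[ℝ] ℝ)
    (c : ι → ℝ) :
    HasExpPsdLift {q : E × ℝ | Real.log (∑ i, Real.exp (a i q.1 + c i)) ≤ q.2}
      (Fintype.card ι + 1) 0 := by
  classical
  set n := Fintype.card ι
  let σ : ι ≃ Fin n := Fintype.equivFin ι
  rw [hasExpPsdLift_zero_iff]
  let X : (E × ℝ) × (Fin n → ℝ) →ₗ[ℝ] E := (LinearMap.fst ℝ E ℝ).comp (LinearMap.fst ℝ _ _)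
  let T : (E × ℝ) × (Fin n → ℝ) →ₗ[ℝ] ℝ := (LinearMap.snd ℝ E ℝ).comp (LinearMap.fst ℝ _ _)
  let Y : Fin n → ((E × ℝ) × (Fin n → ℝ) →ₗ[ℝ] ℝ) := fun j =>
    (LinearMap.proj j).comp (LinearMap.snd ℝ (E × ℝ) (Fin n → ℝ))
  let S : (E × ℝ) × (Fin n → ℝ) →ₗ[ℝ] ℝ := sumCoords (E × ℝ) n
  let Aj : Fin n → ((E × ℝ) × (Fin n → ℝ) →ₗ[ℝ] ℝ × ℝ × ℝ) := fun j =>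
    ((a (σ.symm j)).comp X - T).prod ((0 : _ →ₗ[ℝ] ℝ).prod (Y j))
  let Al : (E × ℝ) × (Fin n → ℝ) →ₗ[ℝ] ℝ × ℝ × ℝ := (0 : _ →ₗ[ℝ] ℝ).prod ((-S).prod (-S))
  refine ⟨n, LinearMap.pi (Fin.snoc Aj Al),
    Fin.snoc (fun j => (c (σ.symm j), (1 : ℝ), (0 : ℝ))) ((0 : ℝ), (1 : ℝ), (1 : ℝ)), fun q => ?_⟩
  obtain ⟨x, t⟩ := q
  have hre : ∑ i, Real.exp (a i x + c i) = ∑ j, Real.exp (a (σ.symm j) x + c (σ.symm j)) :=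
    (Fintype.sum_equiv σ _ _ fun i => by rw [Equiv.symm_apply_apply])
  simp only [Set.mem_setOf_eq, hre, Fin.forall_fin_succ', Pi.add_apply, LinearMap.pi_apply,
    Fin.snoc_castSucc, Fin.snoc_last]
  rw [log_sum_exp_le_iff]
  refine exists_congr fun y => ?_
  have e1 : ∀ j : Fin n, (Aj j ((x, t), y) + (c (σ.symm j), 1, 0) ∈ expCone ↔
      Real.exp (a (σ.symm j) x + c (σ.symm j) - t) ≤ y j) := fun j => by
    change ((a (σ.symm j) x - t, (0 : ℝ), y j) : ℝ × ℝ × ℝ) + (c (σ.symm j), 1, 0) ∈ expCone ↔ _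
    rw [Prod.mk_add_mk, Prod.mk_add_mk, zero_add, add_zero, mem_expCone_one_iff,
      add_sub_right_comm]
  have e2 : Al ((x, t), y) + (0, 1, 1) ∈ expCone ↔ ∑ j, y j ≤ 1 := by
    change (((0 : ℝ), -(∑ j, y j), -(∑ j, y j)) : ℝ × ℝ × ℝ) + (0, 1, 1) ∈ expCone ↔ _
    rw [Prod.mk_add_mk, Prod.mk_add_mk, zero_add, neg_add_eq_sub, mem_expCone_nonneg_iff,
      sub_nonneg]
  simp only [e1, e2]

section freeEnergy

variable {σ : Type*} [Fintype σ]

/-- The linear form `u ↦ ⟨d, u⟩ = Σᵢ dᵢ uᵢ` of an exponent vector `d` (the logarithm of the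
monomial `x^d` at `x = e^u`). [folklore] -/
def monomialLog (d : σ →₀ ℕ) : (σ → ℝ) →ₗ[ℝ] ℝ where
  toFun u := ∑ i, (d i : ℝ) * u i
  map_add' u v := by simp [mul_add, Finset.sum_add_distrib]
  map_smul' r u := by simp [Finset.mul_sum, mul_left_comm]

/-- Unfolding of `monomialLog`. [folklore] -/
theorem monomialLog_apply (d : σ →₀ ℕ) (u : σ → ℝ) : monomialLog d u = ∑ i, (d i : ℝ) * u i :=
  rfl

/-- `f(e^u) = Σ_{d ∈ supp f} exp (⟨d, u⟩ + log c_d)` for a polynomial with positive coefficients on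
its support. [folklore] -/
theorem eval_exp_eq_sum_exp (f : MvPolynomial σ ℝ) (hf : ∀ d ∈ f.support, 0 < f.coeff d)
    (u : σ → ℝ) :
    MvPolynomial.eval (fun i => Real.exp (u i)) f =
      ∑ d : f.support, Real.exp (monomialLog d.1 u + Real.log (f.coeff d.1)) := by
  rw [MvPolynomial.eval_eq', ← Finset.sum_coe_sort]
  refine Finset.sum_congr rfl fun d _ => ?_
  rw [Real.exp_add, Real.exp_log (hf d.1 d.2), mul_comm (Real.exp _), monomialLog_apply,
    Real.exp_sum]
  congr 1
  refine Finset.prod_congr rfl fun i _ => ?_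
  rw [Real.exp_nat_mul]

/-- **The trivial free-energy lift.** For a nonzero polynomial `f` with nonnegative coefficients,
`log f(e^u) = log Σ_{d ∈ supp f} exp (⟨d, u⟩ + log c_d)` is a log-sum-exp of `#supp f` affine
forms, so its epigraph has a lift by `#supp f + 1` exponential cones and no psd block
(e.g. `n! + 1` cones for `per_n`). [folklore] -/
theorem hasExpPsdLift_freeEnergyEpigraph_of_coeff_nonneg (f : MvPolynomial σ ℝ)
    (hf : ∀ d, 0 ≤ f.coeff d) (hf0 : f ≠ 0) :
    HasExpPsdLift (freeEnergyEpigraph f) (f.support.card + 1) 0 := by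
  have hpos : ∀ d ∈ f.support, 0 < f.coeff d := fun d hd =>
    (hf d).lt_of_ne' (MvPolynomial.mem_support_iff.1 hd)
  haveI : Nonempty f.support := Finset.nonempty_coe_sort.2
    (Finset.nonempty_iff_ne_empty.2 (mt MvPolynomial.support_eq_empty.1 hf0))
  have hset : freeEnergyEpigraph f = {q : (σ → ℝ) × ℝ |
      Real.log (∑ d : f.support,
        Real.exp (monomialLog d.1 q.1 + Real.log (f.coeff d.1))) ≤ q.2} := by
    ext q
    rw [freeEnergyEpigraph, Set.mem_setOf_eq, Set.mem_setOf_eq, freeEnergy,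
      eval_exp_eq_sum_exp f hpos]
  rw [hset, ← Fintype.card_coe f.support]
  exact hasExpPsdLift_logSumExp (fun d : f.support => monomialLog d.1)
    fun d => Real.log (f.coeff d.1)

end freeEnergy

/-! ## The Gouveia–Parrilo–Thomas form `C = π (K ∩ L)`

[GPT13, Def. 2.1] (and [WZ20, §3] for non-compact sets) define a `K`-lift of `C ⊆ ℝⁿ` as
`C = π (K ∩ L)` with `L` an affine subspace of the ambient space of the cone `K` and `π` linear.
`HasExpPsdProjLift C k m` is this definition verbatim for `K = K_exp^k × S^m_+ ⊆ LiftSpace k m`.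
We prove that it agrees with the conic-inequality form `HasExpPsdLift` of
`Literature.Analysis.Convex.ConeLift` up to `O(k + m² + dim E)` exponential-cone (LP/equation)
units and with the SAME psd order `m`, for finite-dimensional `E`:

* `HasExpPsdProjLift.hasExpPsdLift`: `π (K ∩ L)` is a linear image of the intersection of `K`
  (identity lift) with an affine subspace (equation units), so it has a conic-inequality lift
  with `k + (dim LiftSpace k m + 1) + dim E` exponential cones (`dim LiftSpace k m = 3k + m²`,
  `finrank_liftSpace`);
* `HasExpPsdLift.hasExpPsdProjLift`: conversely `{x | ∃ y, A (x, y) + b ∈ K}` is `π (K' ∩ L')`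
  for `K' = K_exp^{k + dim E} × S^m_+`: the `dim E` extra triples `(ξᵢ, 1, zᵢ)` carry the
  coordinates `ξ = e x` of `x` as FREE variables (`∃ z, (v, 1, z) ∈ K_exp` for every `v`), `L'`
  is cut out by `middle coordinates = 1` and `w - A (x, 0) - b ∈ range (y ↦ A (0, y))`, and
  `π` reads `x` off `ξ`.

## References

* [GPT13] Gouveia–Parrilo–Thomas, MOR 38 (2013), Def. 2.1 (bib: GouveiaParriloThomas2013).
* [WZ20] Wang–Zhi, J. Syst. Sci. Complex. 33 (2020), §3 (bib: WangZhi2020).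
-/

/-- **`K`-lift in the sense of Gouveia–Parrilo–Thomas**, verbatim for `K = K_exp^k × S^m_+`:
`C = π (K ∩ L)` for an affine subspace `L` of `LiftSpace k m` and a linear map
`π : LiftSpace k m → E`. [cite: GouveiaParriloThomas2013, Def. 2.1] -/
def HasExpPsdProjLift (C : Set E) (k m : ℕ) : Prop :=
  ∃ (L : AffineSubspace ℝ (LiftSpace k m)) (π : LiftSpace k m →ₗ[ℝ] E),
    C = π '' (expPsdCone k m ∩ (L : Set (LiftSpace k m)))

/-- `dim LiftSpace k m = 3k + m²`. [folklore] -/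
theorem finrank_liftSpace (k m : ℕ) : Module.finrank ℝ (LiftSpace k m) = 3 * k + m ^ 2 := by
  rw [Module.finrank_prod, Module.finrank_pi_fintype, Module.finrank_matrix]
  simp only [Module.finrank_prod, Module.finrank_self, Finset.sum_const, Finset.card_univ,
    Fintype.card_fin, smul_eq_mul]
  ring

/-- The cone itself has the identity lift. [folklore] -/
theorem hasExpPsdLift_expPsdCone (k m : ℕ) : HasExpPsdLift (expPsdCone k m) k m := by
  refine ⟨0, LinearMap.fst ℝ _ _, 0, ?_⟩
  ext w
  simp

/-- An affine subspace of a finite-dimensional space is cut out by `≤ dim E` affine equations,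
hence has a lift by `dim E + 1` exponential cones (the `+ 1` covers the empty subspace `⊥`).
[folklore] -/
theorem hasExpPsdLift_affineSubspace [Module.Finite ℝ E] (L : AffineSubspace ℝ E) :
    HasExpPsdLift (L : Set E) (Module.finrank ℝ E + 1) 0 := by
  rcases (L : Set E).eq_empty_or_nonempty with hL | ⟨p₀, hp₀⟩
  · rw [hL]
    exact hasExpPsdLift_empty.mono (by omega) le_rfl
  · have hset : (L : Set E) = {x | L.direction.mkQ x = L.direction.mkQ p₀} := by
      ext x
      rw [SetLike.mem_coe, Set.mem_setOf_eq, Submodule.mkQ_apply, Submodule.mkQ_apply,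
        Submodule.Quotient.eq, ← AffineSubspace.vsub_right_mem_direction_iff_mem hp₀ x,
        vsub_eq_sub]
    rw [hset]
    exact (hasExpPsdLift_setOf_eq _ _).mono
      ((Submodule.finrank_quotient_le _).trans (Nat.le_succ _)) le_rfl

/-- **GPT form ⇒ conic-inequality form** with `k + (3k + m² + 1) + dim E` exponential cones and
the same psd order. [cite: GouveiaParriloThomas2013, Def. 2.1] -/
theorem HasExpPsdProjLift.hasExpPsdLift [Module.Finite ℝ E] {C : Set E} {k m : ℕ}
    (h : HasExpPsdProjLift C k m) :
    HasExpPsdLift C (k + (Module.finrank ℝ (LiftSpace k m) + 1) + Module.finrank ℝ E) m := by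
  obtain ⟨L, π, rfl⟩ := h
  exact ((hasExpPsdLift_expPsdCone k m).inter (hasExpPsdLift_affineSubspace L)).image π

section toGPT

variable (k d m : ℕ)

/-- The first `k` triples and the psd block of `LiftSpace (k + d) m`. [folklore] -/
def headLift : LiftSpace (k + d) m →ₗ[ℝ] LiftSpace k m :=
  ((LinearMap.fst ℝ _ _).comp ((splitFin (ℝ × ℝ × ℝ) k d).comp (LinearMap.fst ℝ _ _))).prod
    (LinearMap.snd ℝ _ _)

/-- The last `d` triples of `LiftSpace (k + d) m`. [folklore] -/
def tailTriples : LiftSpace (k + d) m →ₗ[ℝ] (Fin d → ℝ × ℝ × ℝ) :=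
  (LinearMap.snd ℝ _ _).comp ((splitFin (ℝ × ℝ × ℝ) k d).comp (LinearMap.fst ℝ _ _))

/-- First coordinates of the last `d` triples (they carry a point of `E` in coordinates).
[folklore] -/
def tailFst : LiftSpace (k + d) m →ₗ[ℝ] (Fin d → ℝ) :=
  (LinearMap.pi fun i => (LinearMap.fst ℝ ℝ (ℝ × ℝ)).comp (LinearMap.proj i)).comp
    (tailTriples k d m)

/-- Middle coordinates of the last `d` triples (pinned to `1` by the affine subspace).
[folklore] -/
def tailMid : LiftSpace (k + d) m →ₗ[ℝ] (Fin d → ℝ) :=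
  (LinearMap.pi fun i => (LinearMap.fst ℝ ℝ ℝ).comp
    ((LinearMap.snd ℝ ℝ (ℝ × ℝ)).comp (LinearMap.proj i))).comp (tailTriples k d m)

variable {k d m}

/-- Assembling a point of `LiftSpace (k + d) m` from a head and a tail. [folklore] -/
def consLift (w : LiftSpace k m) (v : Fin d → ℝ × ℝ × ℝ) : LiftSpace (k + d) m :=
  (appendLin (ℝ × ℝ × ℝ) k d (w.1, v), w.2)

/-- `headLift ∘ consLift = id` on the head. [folklore] -/
theorem headLift_consLift (w : LiftSpace k m) (v : Fin d → ℝ × ℝ × ℝ) :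
    headLift k d m (consLift w v) = w := by
  have := splitFin_appendLin (V := ℝ × ℝ × ℝ) (w.1, v)
  change (((splitFin (ℝ × ℝ × ℝ) k d) (appendLin (ℝ × ℝ × ℝ) k d (w.1, v))).1, w.2) = w
  rw [this]

/-- `tailTriples ∘ consLift = id` on the tail. [folklore] -/
theorem tailTriples_consLift (w : LiftSpace k m) (v : Fin d → ℝ × ℝ × ℝ) :
    tailTriples k d m (consLift w v) = v := by
  have := splitFin_appendLin (V := ℝ × ℝ × ℝ) (w.1, v)
  change ((splitFin (ℝ × ℝ × ℝ) k d) (appendLin (ℝ × ℝ × ℝ) k d (w.1, v))).2 = v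
  rw [this]

/-- Unfolding of `tailMid`. [folklore] -/
theorem tailMid_apply (ω : LiftSpace (k + d) m) (i : Fin d) :
    tailMid k d m ω i = (tailTriples k d m ω i).2.1 :=
  rfl

end toGPT

/-- **Conic-inequality form ⇒ GPT form** with `dim E` extra exponential cones and the same psd
order: `{x | ∃ y, A (x, y) + b ∈ K} = π (K' ∩ L')` as described in the module docstring.
[cite: GouveiaParriloThomas2013, Def. 2.1] -/
theorem HasExpPsdLift.hasExpPsdProjLift [Module.Finite ℝ E] {C : Set E} {k m : ℕ}
    (h : HasExpPsdLift C k m) : HasExpPsdProjLift C (k + Module.finrank ℝ E) m := by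
  obtain ⟨p, A, b, rfl⟩ := h
  set d := Module.finrank ℝ E
  let e : E ≃ₗ[ℝ] (Fin d → ℝ) := (Module.finBasis ℝ E).equivFun
  let A₁ : E →ₗ[ℝ] LiftSpace k m := A.comp (LinearMap.inl ℝ E _)
  let A₂ : (Fin p → ℝ) →ₗ[ℝ] LiftSpace k m := A.comp (LinearMap.inr ℝ E _)
  let R : Submodule ℝ (LiftSpace k m) := LinearMap.range A₂
  let π : LiftSpace (k + d) m →ₗ[ℝ] E := e.symm.toLinearMap.comp (tailFst k d m)
  let Φ : LiftSpace (k + d) m →ₗ[ℝ] (Fin d → ℝ) × (LiftSpace k m ⧸ R) :=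
    (tailMid k d m).prod (R.mkQ.comp (headLift k d m - A₁.comp π))
  let c : (Fin d → ℝ) × (LiftSpace k m ⧸ R) := (fun _ => 1, R.mkQ b)
  have hA : ∀ (x : E) (y : Fin p → ℝ), A (x, y) = A₁ x + A₂ y := fun x y => by
    have hxy : ((x, y) : E × (Fin p → ℝ)) = (x, 0) + (0, y) := by simp
    rw [hxy, map_add]
    rfl
  refine ⟨(affineSpan ℝ {c}).comap Φ.toAffineMap, π, ?_⟩
  ext x
  simp only [Set.mem_setOf_eq, Set.mem_image, Set.mem_inter_iff, AffineSubspace.coe_comap,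
    Set.mem_preimage, LinearMap.coe_toAffineMap, AffineSubspace.coe_affineSpan_singleton,
    Set.mem_singleton_iff]
  constructor
  · rintro ⟨y, hy⟩
    have hπ : π (consLift (A (x, y) + b) fun i => (e x i, 1, Real.exp (e x i))) = x := by
      change e.symm (fun i => (tailTriples k d m
        (consLift (A (x, y) + b) fun i => (e x i, 1, Real.exp (e x i))) i).1) = x
      simp only [tailTriples_consLift]
      exact e.symm_apply_apply x
    refine ⟨consLift (A (x, y) + b) (fun i => (e x i, 1, Real.exp (e x i))), ⟨⟨?_, ?_⟩, ?_⟩, hπ⟩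
    · change ∀ i, appendLin (ℝ × ℝ × ℝ) k d
        ((A (x, y) + b).1, fun i => (e x i, 1, Real.exp (e x i))) i ∈ expCone
      rw [forall_appendLin_iff (fun v => v ∈ expCone)]
      exact ⟨hy.1, fun i => mem_expCone_one_iff.2 le_rfl⟩
    · exact hy.2
    · change (tailMid k d m _, R.mkQ (headLift k d m _ - A₁ (π _))) = c
      refine Prod.ext (funext fun i => ?_) ?_
      · change tailMid k d m (consLift (A (x, y) + b) fun i => (e x i, 1, Real.exp (e x i))) i = 1
        rw [tailMid_apply, tailTriples_consLift]
      · change R.mkQ _ = R.mkQ b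
        rw [hπ, headLift_consLift, Submodule.mkQ_apply, Submodule.mkQ_apply,
          Submodule.Quotient.eq, hA]
        exact ⟨y, by abel⟩
  · rintro ⟨ω, ⟨hK, hL⟩, rfl⟩
    have hL' : tailMid k d m ω = (fun _ => 1) ∧ R.mkQ (headLift k d m ω - A₁ (π ω)) = R.mkQ b :=
      Prod.ext_iff.1 hL
    obtain ⟨y, hy⟩ : headLift k d m ω - A₁ (π ω) - b ∈ R := by
      rw [← Submodule.Quotient.eq, ← Submodule.mkQ_apply, ← Submodule.mkQ_apply]
      exact hL'.2
    refine ⟨y, ?_⟩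
    have hw : A (π ω, y) + b = headLift k d m ω := by
      rw [hA]
      rw [hy]
      abel
    rw [hw]
    exact ⟨fun j => hK.1 (Fin.castAdd d j), hK.2⟩

/-- **Equivalence of the two presentations** for finite-dimensional `E`, up to
`O(k + m² + dim E)` exponential-cone units and with the same psd order.
[cite: GouveiaParriloThomas2013, Def. 2.1] -/
theorem hasExpPsdLift_iff_exists_hasExpPsdProjLift [Module.Finite ℝ E] {C : Set E} {m : ℕ} :
    (∃ k, HasExpPsdLift C k m) ↔ ∃ k, HasExpPsdProjLift C k m :=
  ⟨fun ⟨_, h⟩ => ⟨_, h.hasExpPsdProjLift⟩, fun ⟨_, h⟩ => ⟨_, h.hasExpPsdLift⟩⟩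

end Literature.Analysis.Convex
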